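import Summits.Langlands.Langlands.Theses.SenNullAlignment
import HarnessLib

/-!
# Birth skeleton (BC3) for crux stmt-Langlands-16308
`Summit.Langlands.Langlands.Theses.SenNullAlignment.SectorComplement` — line `birth_SenNullAlignment`

Route `route-Langlands-SenNullAlignment` (rev 7; deciding theorem
`closes : SingularProjectiveFinite → NonAlignedAtEll → AlignedAtEll → AwayFromEll → OddNonRegularAttached →
RegularServed → SectorComplement → _root_.Langlands`, which BUILDS the target `X := OddHilbertReciprocity` from the
six other items and then applies this one).  The crux is the route's SECTOR JUNCTION (rank 9, never staffed):

  `SectorComplement := OddHilbertReciprocity → _root_.Langlands`.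

`X = OddHilbertReciprocity` (stmt-Langlands-16357, the route TARGET): direction (A) for `n = 2` over every totally real `K`,
restricted to the L-algebraic cuspidal `π` of `GL₂(𝔸_K)` that are holomorphic of some weight `(k, w)` with totally odd
central sign — for ONE reciprocity datum `RD` per `K` (`∃ RD`): an irreducible `ρ`, geometric for Fontaine's pinned datum,
with `Corresponds RD ι π ρ`.  Refuter + grounder (2026-08-16): target-equivalent by design (`Langlands → SectorComplement :=
fun h _ => h`), "the rest of the summit", open-problem, nothing to refute; no `Disproof.lean` on the crux
(`ledger crux ls stmt-Langlands-16308`, 2026-08-17).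

File name / namespace.  The crux directory `Cruxes/SectorComplement/` is SHARED by the homonymous junction cruxes of
SkinnerWilesDefectOne (stmt-12923, `NOTES.md`), HolomorphicShadow (stmt-14623, registered `Lines/birth.lean`) and
MirrorPairReflection (stmt-12840, `Lines/birth_MirrorPairReflection.lean`); not to clobber them this line is
`Lines/birth_SenNullAlignment.lean`, namespace `…Cruxes.SectorComplement.BirthSenNullAlignment` (the `birth_<Name>` convention).

## The summit as it stands (Statement re-type of 2026-08-17, `∀ 𝓡` + non-vacuity + pinned Artin maps)

  `Langlands := ∀ F, Nonempty (ReciprocityData F) ∧ ∀ (𝓡 : ReciprocityData F) (n > 0) hcpt, (A) ∧ (B)`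

(checked `Iff.rfl` in this session).  Two consequences for any decomposition of "the rest of the summit":
(i) the two sibling birth skeletons (and the landed `IrreducibleOffSector.langlands_of_reciprocityUpToIrreducibility_text_of_JS`
they end in) target the PRE-retype shape `∀ F, ∃ 𝓡, …` and cannot be reused — this file is self-contained over the route module;
(ii) `X` is in `∃ RD` form, so on its own plane it no longer yields the summit's clause for EVERY `𝓡`: what `X` robustly
contributes is the IRREDUCIBLE PINNED-GEOMETRIC AVATAR, Satake–Frobenius compatible a.e. (all `𝓡`-free: `ReciprocityData.pst`
ignores its datum), while local–global compatibility w.r.t. an arbitrary Henniart-normalised `𝓡` is re-supplied by the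
all-data compatibility stub (on the plane this is Henniart's uniqueness of `rec_v` in the only form the summit reads it).

## The skeleton: the summit cut along the odd-Hilbert plane, seam W⁺ / LGC(∀𝓡) / B_w / rigidity / non-vacuity

* `stub_reciprocityDataNonempty` — the non-vacuity conjunct: PINNED reciprocity data exist (Harris–Taylor Thm. A / Henniart for
  THE canonical Artin map and canonically normalised local constants at every completion).  Literature debt (T0), not open;
  NOT the bare named fact `LocalLanglandsDatum.nonempty` any more (the pins `llc_isCanonical`, `llc_eps_isCanonical`).
* `stub_irreducibleAvatarOffPlane` — W⁺ OFF the plane: every L-algebraic cuspidal `π` of `GL_n(𝔸_F)` NOT on the odd-Hilbert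
  plane (`F` totally real ∧ `n = 2` ∧ `π` holomorphic of some weight `(k,w)` with totally odd sign) has, for all `ℓ, ι`, an
  IRREDUCIBLE `ρ` unramified a.e., de Rham above `ℓ` (pinned datum), Satake–Frobenius compatible a.e.  OPEN (BG Conj. 3.2.2 +
  irreducibility: regular algebraic over CM/totally real = HLTT/Scholze + open irreducibility in general; Maass forms, general `F`:
  nothing).  This is the (A)-existence remainder of the summit in weak form.
* `stub_pairCompatibilityAllData` — LGC for EVERY reciprocity datum: every irreducible pinned-geometric `ρ` a.e.-compatible with an
  L-algebraic cuspidal `π` is locally–globally compatible with `π` at EVERY finite place, for every `𝓡 : ReciprocityData F`.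
  OPEN (Taylor 2004 Conj. 7; `∀ 𝓡` replaces the siblings' `∃ Rec` after the re-type).  On the plane it upgrades `X`'s `∃ RD`.
* `stub_weakAutomorphy` — B_w: every irreducible pinned-geometric `ρ` has an L-algebraic cuspidal `π` a.e.-compatible with it.
  OPEN (Fontaine–Mazur Conj. 1 + Langlands), all `F`, all `n` — direction (B) is entirely outside the route's sector.
* `stub_uniqueUpToConjugacy` — rigidity: `ρ` irreducible and `ρ'` both Satake–Frobenius compatible a.e. with the same `π` ⇒
  `ρ' = g ρ g⁻¹`.  A THEOREM in print (Chebotarev + Brauer–Nesbitt + "semisimplification irreducible ⇒ irreducible"); size M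
  (the tree has the semisimple case, `FramedGaloisRep.nonempty_equiv_of_hasFrobCharpolyAt_eventually`, and rank-2
  semisimplification only).

`SectorComplement_of` (kernel-checked, no `sorry`; hypotheses = the five stub statements by name, `_Goal.stub_x := type_of% @stub_x`):
given `X`, for `F, 𝓡, n, hcpt`: (A) take the avatar from `X` ON the plane (case split; `n = 2` substituted, `X`'s `RD`-geometricity
IS `𝓡`-geometricity definitionally) and from `stub_irreducibleAvatarOffPlane` OFF it, complete `Corresponds 𝓡` by
`stub_pairCompatibilityAllData`, uniqueness by `stub_uniqueUpToConjugacy`; (B) = `stub_weakAutomorphy` + `stub_pairCompatibilityAllData`;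
non-vacuity = `stub_reciprocityDataNonempty`.  `X` is LOAD-BEARING (the only source of avatars on the plane); no stub alone gives
the crux or the summit (BC3 probes, `bc/probes_*.lean` of the registering session: all fail).

Disproof used: none exists for this crux.  Negatives index (`ledger negatives --problem Langlands`): no entry bears on these texts.

References: K. Buzzard, T. Gee, LMS LNS 414 (2014), Conj. 3.2.1–3.2.2 [BuzzardGeeLMS2014]; J.-M. Fontaine, B. Mazur (1995),
Conj. 1 [FontaineMazurGeometric1995]; R. Taylor, Ann. Fac. Sci. Toulouse 13 (2004), Conj. 7–8 [TaylorGaloisRepresentations2004];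
M. Harris, R. Taylor, Ann. Math. Stud. 151 (2001), Thm. A [HarrisTaylorAMS2001]; G. Henniart, Invent. Math. 113 (1993), Thm. 1.1
and Invent. Math. 139 (2000), Thm. 1.2 [HenniartInventiones2000]; P. Deligne, J.-P. Serre, ASENS 7 (1974), Lemme 3.2
[DeligneSerreASENS1974]; F. Jarvis, J. reine angew. Math. 491 (1997) [Jarvis1997].
-/

noncomputable section

set_option linter.dupNamespace false -- project-wide option; `Summit.Langlands.Langlands` is the mandated namespace

open scoped NumberField Classical
open Filter IsDedekindDomain
open Literature.NumberTheory.Automorphic Literature.NumberTheory.GaloisRepresentations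
open Summit.Langlands
open Summit.Langlands.Langlands.Theses.SenNullAlignment (OddHilbertReciprocity SectorComplement)

namespace Summit.Langlands.Langlands.Cruxes.SectorComplement.BirthSenNullAlignment

/-! ## 0. The odd-Hilbert plane (the route's sector), by name -/

/-- `π` (cuspidal on `GL_n(𝔸_K)`) is **holomorphic of weight `(k, w)`**: its infinity type is that of `⊗_β D_{k_β, w}` —
VERBATIM the inlined weight-`(k,w)` infinity type of the route text (definitionally the tree's `hilbertInfinityType k w`),
typable for every `n` because `InfinityType K n` does not read `n` (for `n ≠ 2` it is simply false: well-formedness counts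
two weights).  [cite: BuzzardGeeLMS2014, §3.1] -/
def IsHolomorphicOfWeight {K : Type} [Field K] [NumberField K] {n : ℕ}
    {hcpt : Literature.NumberTheory.Automorphic.isCompact_glFiniteIntegralLevel n K}
    (π : Literature.NumberTheory.Automorphic.CuspidalAutomorphicRepData n K hcpt) (k : (K →+* ℂ) → ℕ) (w : ℤ) : Prop :=
  π.1.HasInfinityType (fun β : K →+* ℂ => ({(⟨((k β : ℂ) - 1 - w) / 2, (1 - (k β : ℂ) - w) / 2, (k β : ℤ) - 1, by push_cast; ring⟩ : Literature.NumberTheory.Automorphic.ArchWeight), (⟨((k β : ℂ) - 1 - w) / 2, (1 - (k β : ℂ) - w) / 2, (k β : ℤ) - 1, by push_cast; ring⟩ : Literature.NumberTheory.Automorphic.ArchWeight).swap} : Multiset Literature.NumberTheory.Automorphic.ArchWeight))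

/-- `π` has **totally odd central sign**: the idèle `−1` at each infinite place `u` (Mathlib's `Units.map inl ∘ mulSingle`,
definitionally the tree's `infiniteIdeleSingle u (-1)`) acts by `−1` on `π = W / W'` — VERBATIM the route text, with `2 ↦ n`.
[cite: Jarvis1997, §1] -/
def IsTotallyOddSign {K : Type} [Field K] [NumberField K] {n : ℕ}
    {hcpt : Literature.NumberTheory.Automorphic.isCompact_glFiniteIntegralLevel n K}
    (π : Literature.NumberTheory.Automorphic.CuspidalAutomorphicRepData n K hcpt) : Prop :=
  ∀ (u : NumberField.InfinitePlace K), ∀ φ ∈ π.1.W, Literature.NumberTheory.Automorphic.rightTranslation (Literature.NumberTheory.Automorphic.AdelicGroupData.gl n K) (Matrix.GeneralLinearGroup.scalar (Fin n) (Units.map (MonoidHom.inl (NumberField.InfiniteAdeleRing K) (IsDedekindDomain.FiniteAdeleRing (NumberField.RingOfIntegers K) K) : NumberField.InfiniteAdeleRing K →* NumberField.AdeleRing (NumberField.RingOfIntegers K) K) (Units.map (MonoidHom.mulSingle (fun u' : NumberField.InfinitePlace K => u'.Completion) u : u.Completion →* NumberField.InfiniteAdeleRing K) (-1)))) φ + φ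 ∈ π.1.W'

/-- **The odd-Hilbert plane** — the sector of the summit that `X = OddHilbertReciprocity` speaks about: `K` totally real,
`n = 2`, `π` holomorphic of some weight `(k, w)` with totally odd central sign. [cite: Jarvis1997, §1] -/
def OnOddHilbertPlane (K : Type) [Field K] [NumberField K] (n : ℕ)
    (hcpt : Literature.NumberTheory.Automorphic.isCompact_glFiniteIntegralLevel n K)
    (π : Literature.NumberTheory.Automorphic.CuspidalAutomorphicRepData n K hcpt) : Prop :=
  NumberField.IsTotallyReal K ∧ n = 2 ∧ ∃ (k : (K →+* ℂ) → ℕ) (w : ℤ), IsHolomorphicOfWeight π k w ∧ IsTotallyOddSign π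

/-- The crux IS `X → Langlands`, by name. [folklore] -/
theorem sectorComplement_iff : SectorComplement ↔ (OddHilbertReciprocity → _root_.Langlands) :=
  Iff.rfl

/-! ## 1. The five stubs (the ONLY sorries of this file) -/

/-- **stub N — non-vacuity: pinned reciprocity data exist** (Harris–Taylor 2001 Thm. A / Henniart 2000 Thm. 1.2 for THE
canonical local Artin map, with Deligne's local constants normalised canonically at every finite extension; literature debt,
true in print).  Not the bare named fact `LocalLanglandsDatum.nonempty`: the fields `llc_isCanonical` / `llc_eps_isCanonical`
of the re-typed `ReciprocityData` demand the canonical normalisation.  Why it might fail: only if the tree's `IsLocalLanglandsGL`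
clauses were unsatisfiable against `canonicalArtin` (a typing artefact, which would make the summit itself false).
[cite: HarrisTaylorAMS2001, Thm. A] [cite: HenniartInventiones2000, Thm. 1.2] -/
theorem stub_reciprocityDataNonempty : ∀ (F : Type) [Field F] [NumberField F], Nonempty (ReciprocityData F) := by
  sorry

/-- **stub W⁺ — an irreducible pinned-geometric avatar OFF the odd-Hilbert plane** (Buzzard–Gee Conj. 3.2.2, weak form, WITH
irreducibility; OPEN: for regular algebraic `π` over CM / totally real `F` the avatar is Harris–Lan–Taylor–Thorne 2016 Thm. A /
Scholze 2015 V.4.2, de Rham in the crystalline range (A'Campo, Caraiani–Newton), irreducibility open in general (known in low rank /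
for a density-one set of `ℓ`); nothing for Maass forms (NonRegularWeightBarrier) or `F` neither CM nor totally real
(ShimuraVarietyRealizationBarrier)): every L-algebraic cuspidal `π` of `GL_n(𝔸_F)` NOT on the odd-Hilbert plane has, for all
`ℓ, ι`, an irreducible `ρ : Γ_F → GL_n(ℚ̄_ℓ)` unramified a.e., de Rham above `ℓ` for Fontaine's pinned datum, Satake–Frobenius
compatible with `π` a.e.  Why it might fail: it is the (A)-existence rest of the summit (weak form).
[cite: BuzzardGeeLMS2014, Conj. 3.2.2] [cite: FontaineMazurGeometric1995, §1] -/
theorem stub_irreducibleAvatarOffPlane : ∀ (F : Type) [Field F] [NumberField F] (n : ℕ) (hcpt : Literature.NumberTheory.Automorphic.isCompact_glFiniteIntegralLevel n F), 0 < n → ∀ (π : Literature.NumberTheory.Automorphic.CuspidalAutomorphicRepData n F hcpt), π.1.IsLAlgebraic → ¬ OnOddHilbertPlane F n hcpt π → ∀ (ℓ : ℕ) [Fact ℓ.Prime] (ι : PadicAlgCl ℓ ≃+* ℂ), ∃ ρ : Literature.NumberTheory.GaloisRepresentations.FramedGaloisRep F (PadicAlgCl ℓ) n, ρ.toGaloisRep.IsIrreducible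 ∧ ((∀ᶠ v : IsDedekindDomain.HeightOneSpectrum (NumberField.RingOfIntegers F) in cofinite, ρ.IsUnramifiedAt v) ∧ ∀ (v : IsDedekindDomain.HeightOneSpectrum (NumberField.RingOfIntegers F)) (hv : ((ℓ : ℕ) : NumberField.RingOfIntegers F) ∈ v.asIdeal), (Literature.NumberTheory.PAdicHodge.fontainePstAdicCompletion v ℓ hv).IsDeRhamFramed (ρ.toLocal v)) ∧ ∀ᶠ v : IsDedekindDomain.HeightOneSpectrum (NumberField.RingOfIntegers F) in cofinite, SatakeFrobCompatibleAt ι π.1 ρ v := by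
  sorry

/-- **stub LGC(∀𝓡) — local–global compatibility for compatible pairs, for EVERY reciprocity datum** (Taylor 2004 Conj. 7 at
every finite place — Grothendieck–Deligne recipe at `v ∤ ℓ`, Fontaine's pinned `D_pst` at `v ∣ ℓ` — relative to every
Henniart-normalised `𝓡`; OPEN in general: regular algebraic conjugate self-dual over CM (Harris–Taylor, Taylor–Yoshida, Caraiani),
`v ∤ ℓ` up to monodromy beyond (Varma), Hilbert regular weights (Carayol, Saito, Skinner, Liu); open for irregular `π`, at `v ∣ ℓ`
in general, and — as `∀ 𝓡` — it carries Henniart's uniqueness of `rec_v` on the classes the summit reads): every irreducible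
pinned-geometric `ρ` Satake–Frobenius compatible a.e. with an L-algebraic cuspidal `π` satisfies `LocalGlobalCompatibleAt 𝓡 ι π ρ v`
at every finite `v`.  Why it might fail: an a.e.-compatible irreducible pair with a local mismatch at a ramified place, or two
Henniart-normalised data disagreeing on a local component (the tree pins `rec` on supercuspidals only), refutes it.
[cite: TaylorGaloisRepresentations2004, Conj. 7] [cite: HarrisTaylorAMS2001, Thm. A] [cite: HenniartInventiones2000, Thm. 1.2] -/
theorem stub_pairCompatibilityAllData : ∀ (F : Type) [Field F] [NumberField F] (𝓡 : ReciprocityData F) (n : ℕ) (hcpt : Literature.NumberTheory.Automorphic.isCompact_glFiniteIntegralLevel n F), 0 < n → ∀ (π : Literature.NumberTheory.Automorphic.CuspidalAutomorphicRepData n F hcpt), π.1.IsLAlgebraic → ∀ (ℓ : ℕ) [Fact ℓ.Prime] (ι : PadicAlgCl ℓ ≃+* ℂ) (ρ : Literature.NumberTheory.GaloisRepresentations.FramedGaloisRep F (PadicAlgCl ℓ) n), ρ.toGaloisRep.IsIrreducible → ((∀ᶠ v : IsDedekindDomain.HeightOneSpectrum (NumberField.RingOfIntegers F) in cofinite, ρ.IsUnramifiedAt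 v) ∧ ∀ (v : IsDedekindDomain.HeightOneSpectrum (NumberField.RingOfIntegers F)) (hv : ((ℓ : ℕ) : NumberField.RingOfIntegers F) ∈ v.asIdeal), (Literature.NumberTheory.PAdicHodge.fontainePstAdicCompletion v ℓ hv).IsDeRhamFramed (ρ.toLocal v)) → (∀ᶠ v : IsDedekindDomain.HeightOneSpectrum (NumberField.RingOfIntegers F) in cofinite, SatakeFrobCompatibleAt ι π.1 ρ v) → ∀ v : IsDedekindDomain.HeightOneSpectrum (NumberField.RingOfIntegers F), LocalGlobalCompatibleAt 𝓡 ι π.1 ρ v := by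
  sorry

/-- **stub B_w — weak automorphy of irreducible geometric representations** (Fontaine–Mazur 1995 Conj. 1 + Langlands, a.e. form,
every `n ≥ 1`, every number field `F`; OPEN — known for odd Artin and odd regular `GL₂/ℚ` (Khare–Wintenberger, Kisin, Emerton, Pan),
regular Hodge–Tate weights under automorphy-lifting provisos (BLGGT 2014, ACC+ 2023, Boxer–Calegari–Gee–Pilloni), `GL₁` (class field
theory); open for even / irregular / non-self-dual / general `F`): every irreducible `ρ : Γ_F → GL_n(ℚ̄_ℓ)` unramified a.e. and de
Rham above `ℓ` (pinned datum) has an L-algebraic cuspidal `π` Satake–Frobenius compatible a.e.  Why it might fail: it is direction (B)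
of the summit in weak form — entirely outside the route's sector.
[cite: FontaineMazurGeometric1995, Conj. 1] [cite: BuzzardGeeLMS2014, Conj. 3.2.2] -/
theorem stub_weakAutomorphy : ∀ (F : Type) [Field F] [NumberField F] (n : ℕ) (hcpt : Literature.NumberTheory.Automorphic.isCompact_glFiniteIntegralLevel n F), 0 < n → ∀ (ℓ : ℕ) [Fact ℓ.Prime] (ι : PadicAlgCl ℓ ≃+* ℂ) (ρ : Literature.NumberTheory.GaloisRepresentations.FramedGaloisRep F (PadicAlgCl ℓ) n), ρ.toGaloisRep.IsIrreducible → ((∀ᶠ v : IsDedekindDomain.HeightOneSpectrum (NumberField.RingOfIntegers F) in cofinite, ρ.IsUnramifiedAt v) ∧ ∀ (v : IsDedekindDomain.HeightOneSpectrum (NumberField.RingOfIntegers F)) (hv : ((ℓ : ℕ) : NumberField.RingOfIntegers F) ∈ v.asIdeal), (Literature.NumberTheory.PAdicHodge.fontainePstAdicCompletion v ℓ hv).IsDeRhamFramed (ρ.toLocal v)) → ∃ π : Literature.NumberTheory.Automorphic.CuspidalAutomorphicRepData n F hcpt, π.1.IsLAlgebraic ∧ ∀ᶠ v : IsDedekindDomain.HeightOneSpectrum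 (NumberField.RingOfIntegers F) in cofinite, SatakeFrobCompatibleAt ι π.1 ρ v := by
  sorry

/-- **stub R — rigidity: uniqueness up to conjugacy** (a THEOREM in print: Chebotarev density + continuity give equal
characteristic polynomials everywhere; Brauer–Nesbitt gives `ρ'ˢˢ ≅ ρˢˢ = ρ`; an irreducible semisimplification forces `ρ'`
irreducible, hence `ρ' ≅ ρ`, i.e. `ρ' = g ρ g⁻¹`; size M — the tree has the semisimple case
`FramedGaloisRep.nonempty_equiv_of_hasFrobCharpolyAt_eventually` + `FramedRep.exists_eq_conj_of_equiv` and rank-2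
semisimplification only): if `ρ` is irreducible and `ρ, ρ'` are both Satake–Frobenius compatible a.e. with the same cuspidal `π`,
then `IsConjugate ρ ρ'`.  Why it might fail: only through the framed/conjugacy packaging (`IsConjugate` is `∃ g, conj g ρ = ρ'`).
[cite: DeligneSerreASENS1974, Lemme 3.2] [cite: BuzzardGeeLMS2014, Conj. 3.2.1] -/
theorem stub_uniqueUpToConjugacy : ∀ (F : Type) [Field F] [NumberField F] (n : ℕ) (hcpt : Literature.NumberTheory.Automorphic.isCompact_glFiniteIntegralLevel n F) (π : Literature.NumberTheory.Automorphic.CuspidalAutomorphicRepData n F hcpt) (ℓ : ℕ) [Fact ℓ.Prime] (ι : PadicAlgCl ℓ ≃+* ℂ) (ρ ρ' : Literature.NumberTheory.GaloisRepresentations.FramedGaloisRep F (PadicAlgCl ℓ) n), ρ.toGaloisRep.IsIrreducible → (∀ᶠ v : IsDedekindDomain.HeightOneSpectrum (NumberField.RingOfIntegers F) in cofinite, SatakeFrobCompatibleAt ι π.1 ρ v) → (∀ᶠ v : IsDedekindDomain.HeightOneSpectrum (NumberField.RingOfIntegers F) in cofinite, SatakeFrobCompatibleAt ι π.1 ρ'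 v) → IsConjugate ρ ρ' := by
  sorry

/-! ## 2. The stub statements as named propositions (hypotheses of the composition, admissible by stub name)

Each `_Goal.stub_x` is `type_of% @stub_x`: literally the stub's statement, no text duplicated, no `sorry` inherited. -/

namespace _Goal

/-- The statement of `stub_reciprocityDataNonempty` (literally its type). [folklore] -/
def stub_reciprocityDataNonempty : Prop :=
  type_of% @Summit.Langlands.Langlands.Cruxes.SectorComplement.BirthSenNullAlignment.stub_reciprocityDataNonempty

/-- The statement of `stub_irreducibleAvatarOffPlane` (literally its type). [folklore] -/
def stub_irreducibleAvatarOffPlane : Prop :=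
  type_of% @Summit.Langlands.Langlands.Cruxes.SectorComplement.BirthSenNullAlignment.stub_irreducibleAvatarOffPlane

/-- The statement of `stub_pairCompatibilityAllData` (literally its type). [folklore] -/
def stub_pairCompatibilityAllData : Prop :=
  type_of% @Summit.Langlands.Langlands.Cruxes.SectorComplement.BirthSenNullAlignment.stub_pairCompatibilityAllData

/-- The statement of `stub_weakAutomorphy` (literally its type). [folklore] -/
def stub_weakAutomorphy : Prop :=
  type_of% @Summit.Langlands.Langlands.Cruxes.SectorComplement.BirthSenNullAlignment.stub_weakAutomorphy

/-- The statement of `stub_uniqueUpToConjugacy` (literally its type). [folklore] -/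
def stub_uniqueUpToConjugacy : Prop :=
  type_of% @Summit.Langlands.Langlands.Cruxes.SectorComplement.BirthSenNullAlignment.stub_uniqueUpToConjugacy

end _Goal

/-! ## 3. The composition (kernel-checked, no `sorry`): N → W⁺(off-plane) → LGC(∀𝓡) → B_w → R → SectorComplement -/

/-- **`SectorComplement` from its five stubs.**  Given `X = OddHilbertReciprocity` (the crux's antecedent) and `F, 𝓡, n, hcpt`:
non-vacuity is stub N; in clause (A) the irreducible pinned-geometric a.e.-compatible avatar of `π` comes from `X` ON the
odd-Hilbert plane (`n = 2` substituted; `X`'s `RD`-geometricity is `𝓡`-geometricity definitionally, `ReciprocityData.pst`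
ignoring its datum) and from stub W⁺ OFF it; `Corresponds 𝓡` is completed by stub LGC(∀𝓡) and uniqueness up to conjugacy is
stub R; clause (B) is stub B_w completed by stub LGC(∀𝓡).  Hypotheses = the five stub statements by name; conclusion = the
route decl by name.  [cite: BuzzardGeeLMS2014, Conj. 3.2.1 and Conj. 3.2.2] [cite: FontaineMazurGeometric1995, Conj. 1] -/
theorem SectorComplement_of (hN : _Goal.stub_reciprocityDataNonempty) (hW : _Goal.stub_irreducibleAvatarOffPlane)
    (hL : _Goal.stub_pairCompatibilityAllData) (hB : _Goal.stub_weakAutomorphy)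
    (hU : _Goal.stub_uniqueUpToConjugacy) : SectorComplement := by
  rw [sectorComplement_iff]
  intro hX F _ _
  dsimp only [_Goal.stub_reciprocityDataNonempty, _Goal.stub_irreducibleAvatarOffPlane,
    _Goal.stub_pairCompatibilityAllData, _Goal.stub_weakAutomorphy, _Goal.stub_uniqueUpToConjugacy] at hN hW hL hB hU
  refine ⟨hN F, fun 𝓡 n hn hcpt => ⟨?_, ?_⟩⟩
  · -- (A) automorphic → Galois, for every `𝓡`
    intro π hLalg ℓ _ ι
    -- an irreducible avatar, geometric for `𝓡` (= pinned), Satake–Frobenius compatible a.e.: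
    -- from `X` on the odd-Hilbert plane, from stub W⁺ off it
    have hav : ∃ ρ : FramedGaloisRep F (PadicAlgCl ℓ) n, ρ.toGaloisRep.IsIrreducible ∧
        IsGeometricFramed 𝓡 ρ ∧
          ∀ᶠ v : HeightOneSpectrum (𝓞 F) in cofinite, SatakeFrobCompatibleAt ι π.1 ρ v := by
      by_cases hplane : OnOddHilbertPlane F n hcpt π
      · obtain ⟨hK, hn2, k, w, hhol, hodd⟩ := hplane
        subst hn2
        obtain ⟨RD₀, hRD₀⟩ := hX F hK
        obtain ⟨ρ, hirr, hgeo, hcorr⟩ := hRD₀ hcpt π k w hLalg hhol hodd ℓ ι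
        exact ⟨ρ, hirr, hgeo, hcorr.1⟩
      · obtain ⟨ρ, hirr, hgeo, hsat⟩ := hW F n hcpt hn π hLalg hplane ℓ ι
        exact ⟨ρ, hirr, hgeo, hsat⟩
    obtain ⟨ρ, hirr, hgeo, hsat⟩ := hav
    have hlgc : ∀ v : HeightOneSpectrum (𝓞 F), LocalGlobalCompatibleAt 𝓡 ι π.1 ρ v :=
      hL F 𝓡 n hcpt hn π hLalg ℓ ι ρ hirr hgeo hsat
    exact ⟨ρ, hirr, hgeo, ⟨hsat, hlgc⟩, fun ρ' hcorr' => hU F n hcpt π ℓ ι ρ ρ' hirr hsat hcorr'.1⟩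
  · -- (B) Galois → automorphic, for every `𝓡`
    intro ℓ _ ι ρ hirr hgeo
    obtain ⟨π, hLalg, hsat⟩ := hB F n hcpt hn ℓ ι ρ hirr hgeo
    exact ⟨π, hLalg, hsat, hL F 𝓡 n hcpt hn π hLalg ℓ ι ρ hirr hgeo hsat⟩

/-- By-name sanity check (an `example`, not a declaration): the five stubs feed the composition as they stand. -/
example : SectorComplement :=
  SectorComplement_of stub_reciprocityDataNonempty stub_irreducibleAvatarOffPlane stub_pairCompatibilityAllData
    stub_weakAutomorphy stub_uniqueUpToConjugacy

/-- The converse direction is trivial by design (the junction is target-equivalent: `Langlands → SectorComplement`,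
`fun h _ => h`); recorded as an `example` for the BC2 census (so that no declaration of this workfile reads as a proof
of the item), not a probe. -/
example (h : _root_.Langlands) : SectorComplement :=
  fun _ => h

end Summit.Langlands.Langlands.Cruxes.SectorComplement.BirthSenNullAlignment

end
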